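import Summits.CriticalPhenomena.PercolationContinuityZ3.Theorems.PercNearOneGluingNoHeavyLowerTailSahiTwoLevelIndependentTopsC3

/-!
# THE SHARED-COINS LADDER: two-level laws for tops sharing `≤ k` coins ⟹ Kahn's `C_3` for two events sharing `≤ k + 1` coins

Companion of `…SahiTwoLevelIndependentTops(Pair,C3)` (cell `prim-bnk`, seat bnk-2 gen 16; `--supports stmt-CriticalPhenomena-4575`;
memo `run/shared/lean/prim/prim-l12/FROM-prim-bnk-2-g16-INDEPENDENT-TOPS.md` §7).  No definition, no sorry, standard axioms.

`…IndependentTopsC3` proved Kahn's Conjecture 5 for triples of increasing events two of which share at most ONE coin, from the two-level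
laws (`twoLevelForm ≥ 0`, `twoLevelForm − ∏δ ≥ 0`) at nested pairs whose tops have DISJOINT supports (the theorem of `…IndependentTops`).
The argument is uniform: along a shared coin `e` the fibre cubic of `E_3` has Bernstein coefficients
`E_3(0-sections)`, `T(sections)`, `T⁺(sections)`, `E_3(1-sections)` (up to the positive factors `(1−s)², s(1−s)², s²(1−s), s²`), and the
sections share one coin fewer.  Hence (`sahiE_three_nonneg_of_twoLevelShared`):

**THEOREM (reduction, every `k`).**  Fix a finite cube and a product weight.  IF the two two-level laws hold at every nested pair of
increasing triples whose tops `G 0`, `G 1` are determined by sets `S₀`, `S₁` with `|S₀ ∩ S₁| ≤ k`, THEN `E_3(μ_p; 1_A, 1_B, 1_C) ≥ 0` for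
all increasing `A` (determined by `S₀`), `B` (determined by `S₁`) with `|S₀ ∩ S₁| ≤ k + 1` and every increasing `C`.

The hypothesis at `k = 0` is the independent-tops theorem (`twoLevelShared_zero`); with it the ladder re-derives the `≤ 1`-shared-coin case
(`…IndependentTopsC3.prodBernoulli_sahiE3_nonneg_of_card_inter_le_one`, not restated here).  The hypothesis at `k = 1` — the two-level laws for tops sharing ONE coin — is
OPEN (census-clean: it is contained in the `m ≤ 5` exhaustive census of `SahiTwoLevelPlusPrime`, and exact best-response search over the
bottoms with continuous `p` on `6–8` coins finds no negative value, bnk-2 gen 16); by this file it would give Kahn's `C_3` for every triple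
in which two of the events share at most TWO coins, which is not in the tree.  Kahn's Conjecture 5 in general remains OPEN. [this work]
-/

noncomputable section

open scoped Classical

namespace Summit.CriticalPhenomena.PercolationContinuityZ3.Theorems

namespace SahiTwoLevelIndep

open Finset MeasureTheory
open Literature.Combinatorics.Sahi2008
open Literature.Probability.LatticeModels (prodBernoulli prodBernoulli_sahiE3_nonneg_of_determinedBy)
open Literature.Probability.Percolation (DeterminedBy)
open Literature.Probability.Percolation.DecisionTree (ind)

variable {ι : Type} [Fintype ι]

/-- **THE SHARED-COINS LADDER.**  If, under the product weight `p`, both two-level laws (`T ≥ 0` and `T⁺ = T − ∏δ ≥ 0`, measures written as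
`ex (bernoulliWeight p) ∘ ind`) hold at every nested pair of increasing triples whose tops `G 0`, `G 1` are determined by finite sets sharing at
most `k` coins, then `E_3(μ_p; 1_A, 1_B, 1_C) ≥ 0` whenever `A`, `B` are increasing and determined by sets sharing at most `k + 1` coins and `C`
is increasing (induction on the number of shared coins; one-coordinate Bernstein form along a shared coin). [this work] -/
theorem sahiE_three_nonneg_of_twoLevelShared (p : ι → unitInterval) (k : ℕ)
    (hyp : ∀ (S₀ S₁ : Finset ι) (G H : Fin 3 → Set (Set ι)), (∀ i, IsUpperSet (G i)) → (∀ i, IsUpperSet (H i)) → (∀ i, H i ⊆ G i) →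
      DeterminedBy (G 0) (↑S₀ : Set ι) → DeterminedBy (G 1) (↑S₁ : Set ι) → (S₀ ∩ S₁).card ≤ k →
        0 ≤ twoLevelForm (fun X => ex (bernoulliWeight p) (ind X)) G H ∧
        0 ≤ twoLevelForm (fun X => ex (bernoulliWeight p) (ind X)) G H
              - ∏ i, (ex (bernoulliWeight p) (ind (G i)) - ex (bernoulliWeight p) (ind (H i)))) :
    ∀ (j : ℕ), j ≤ k + 1 → ∀ (S₀ S₁ : Finset ι) (A B C : Set (Set ι)), IsUpperSet A → IsUpperSet B → IsUpperSet C →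
      DeterminedBy A (↑S₀ : Set ι) → DeterminedBy B (↑S₁ : Set ι) → (S₀ ∩ S₁).card ≤ j →
        0 ≤ sahiE (bernoulliWeight p) 3 ![ind A, ind B, ind C] := by
  intro j
  induction j with
  | zero =>
    intro _ S₀ S₁ A B C hA hB hC hAS hBS hS
    have hd : Disjoint S₀ S₁ := Finset.disjoint_iff_inter_eq_empty.2 (Finset.card_eq_zero.1 (Nat.le_zero.1 hS))
    rw [sahiE_three_ind]
    exact prodBernoulli_sahiE3_nonneg_of_determinedBy p hd hAS hBS hA hB hC MeasurableSet.of_discrete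
      MeasurableSet.of_discrete MeasurableSet.of_discrete
  | succ j ih =>
    intro hj S₀ S₁ A B C hA hB hC hAS hBS hS
    -- either the supports already share `≤ j` coins, or pick a shared coin `e`
    by_cases hle : (S₀ ∩ S₁).card ≤ j
    · exact ih (by omega) S₀ S₁ A B C hA hB hC hAS hBS hle
    · have hpos : 0 < (S₀ ∩ S₁).card := by omega
      obtain ⟨e, he⟩ := Finset.card_pos.1 hpos
      have he0 : e ∈ S₀ := (Finset.mem_inter.1 he).1
      have he1 : e ∈ S₁ := (Finset.mem_inter.1 he).2
      -- the sections are determined by `S₀ ∖ {e}`, `S₁ ∖ {e}`, which share `≤ j` coins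
      have hAsec : ∀ b, DeterminedBy (secAt e b A) (↑(S₀.erase e) : Set ι) := fun b => determinedBy_secAt e b hAS
      have hBsec : ∀ b, DeterminedBy (secAt e b B) (↑(S₁.erase e) : Set ι) := fun b => determinedBy_secAt e b hBS
      have hcard : (S₀.erase e ∩ S₁.erase e).card ≤ j := by
        have h1 : S₀.erase e ∩ S₁.erase e = (S₀ ∩ S₁).erase e := by
          ext x; simp only [Finset.mem_inter, Finset.mem_erase]; tauto
        rw [h1, Finset.card_erase_of_mem he]
        omega
      -- `E_3` of both section triples (induction hypothesis at `j`)
      have hB0 : 0 ≤ sahiE (bernoulliWeight p) 3 ![ind (secAt e false A), ind (secAt e false B), ind (secAt e false C)] :=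
        ih (by omega) _ _ _ _ _ (isUpperSet_secAt e false hA) (isUpperSet_secAt e false hB) (isUpperSet_secAt e false hC)
          (hAsec false) (hBsec false) hcard
      have hB3 : 0 ≤ sahiE (bernoulliWeight p) 3 ![ind (secAt e true A), ind (secAt e true B), ind (secAt e true C)] :=
        ih (by omega) _ _ _ _ _ (isUpperSet_secAt e true hA) (isUpperSet_secAt e true hB) (isUpperSet_secAt e true hC)
          (hAsec true) (hBsec true) hcard
      -- the two-level laws at the nested sections (hypothesis, `≤ j ≤ k` shared coins)
      have hG : ∀ i, IsUpperSet ((![secAt e true A, secAt e true B, secAt e true C] : Fin 3 → Set (Set ι)) i) := by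
        intro i; fin_cases i
        · exact isUpperSet_secAt e true hA
        · exact isUpperSet_secAt e true hB
        · exact isUpperSet_secAt e true hC
      have hH : ∀ i, IsUpperSet ((![secAt e false A, secAt e false B, secAt e false C] : Fin 3 → Set (Set ι)) i) := by
        intro i; fin_cases i
        · exact isUpperSet_secAt e false hA
        · exact isUpperSet_secAt e false hB
        · exact isUpperSet_secAt e false hC
      have hHG : ∀ i, (![secAt e false A, secAt e false B, secAt e false C] : Fin 3 → Set (Set ι)) i ⊆
          (![secAt e true A, secAt e true B, secAt e true C] : Fin 3 → Set (Set ι)) i := by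
        intro i; fin_cases i
        · exact SahiTwoLevel.secAt_false_subset_true e hA
        · exact SahiTwoLevel.secAt_false_subset_true e hB
        · exact SahiTwoLevel.secAt_false_subset_true e hC
      have h0 : DeterminedBy ((![secAt e true A, secAt e true B, secAt e true C] : Fin 3 → Set (Set ι)) 0) (↑(S₀.erase e) : Set ι) :=
        hAsec true
      have h1 : DeterminedBy ((![secAt e true A, secAt e true B, secAt e true C] : Fin 3 → Set (Set ι)) 1) (↑(S₁.erase e) : Set ι) :=
        hBsec true
      obtain ⟨hT, hTp⟩ := hyp (S₀.erase e) (S₁.erase e) _ _ hG hH hHG h0 h1 (by omega)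
      -- the one-coordinate Bernstein decomposition and the bridge identities
      have hdec := SahiCoordinateBernstein.sahiE_three_decomp_coord p e ![A, B, C]
      rw [Pointwise.ind_vec3, SahiCoordinateTwoThirds.ind_secAt_vec3, SahiCoordinateTwoThirds.ind_secAt_vec3] at hdec
      have hb1 := SahiTwoLevel.coordPiece₁_add_eq_twoLevelForm p e A B C
      have hb2 := SahiTwoLevel.coordPiece₂_add_eq_twoLevelPlus p e A B C
      have hT' : 0 ≤ SahiCoordinateBernstein.coordPiece₁ p e ![A, B, C]
          + sahiE (bernoulliWeight p) 3 ![ind (secAt e false A), ind (secAt e false B), ind (secAt e false C)]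
          + sahiE (bernoulliWeight p) 3 ![ind (secAt e true A), ind (secAt e true B), ind (secAt e true C)] := by
        rw [hb1]; exact hT
      have hTp' : 0 ≤ SahiCoordinateBernstein.coordPiece₂ p e ![A, B, C]
          + sahiE (bernoulliWeight p) 3 ![ind (secAt e false A), ind (secAt e false B), ind (secAt e false C)]
          + sahiE (bernoulliWeight p) 3 ![ind (secAt e true A), ind (secAt e true B), ind (secAt e true C)] := by
        rw [hb2]; exact hTp
      rw [hdec]
      have hs0 : 0 ≤ (p e : ℝ) := (p e).2.1
      have hs1 : 0 ≤ 1 - (p e : ℝ) := sub_nonneg.2 (p e).2.2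
      nlinarith [mul_nonneg (mul_nonneg hs1 hs1) hB0, mul_nonneg (mul_nonneg hs0 hs0) hB3,
        mul_nonneg (mul_nonneg hs0 (mul_nonneg hs1 hs1)) hT', mul_nonneg (mul_nonneg (mul_nonneg hs0 hs0) hs1) hTp']

/-- **The rung `k = 0` of the ladder is a theorem**: both two-level laws hold at every nested pair whose tops are determined by DISJOINT
sets of coins (`…SahiTwoLevelIndependentTops`). [this work] -/
theorem twoLevelShared_zero (p : ι → unitInterval) (S₀ S₁ : Finset ι) (G H : Fin 3 → Set (Set ι))
    (hG : ∀ i, IsUpperSet (G i)) (hH : ∀ i, IsUpperSet (H i)) (hHG : ∀ i, H i ⊆ G i)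
    (h0 : DeterminedBy (G 0) (↑S₀ : Set ι)) (h1 : DeterminedBy (G 1) (↑S₁ : Set ι)) (hS : (S₀ ∩ S₁).card ≤ 0) :
    0 ≤ twoLevelForm (fun X => ex (bernoulliWeight p) (ind X)) G H ∧
    0 ≤ twoLevelForm (fun X => ex (bernoulliWeight p) (ind X)) G H
          - ∏ i, (ex (bernoulliWeight p) (ind (G i)) - ex (bernoulliWeight p) (ind (H i))) := by
  have hd : Disjoint S₀ S₁ := Finset.disjoint_iff_inter_eq_empty.2 (Finset.card_eq_zero.1 (Nat.le_zero.1 hS))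
  have h0' : DeterminedBy (G 0) (↑S₁ : Set ι)ᶜ :=
    h0.mono fun x hx hx1 => Finset.disjoint_left.1 hd (Finset.mem_coe.1 hx) (Finset.mem_coe.1 hx1)
  have hT := twoLevelForm_nonneg_of_determinedBy p S₁ G H hG hH hHG h0' h1
  have hTp := twoLevelPlus_nonneg_of_determinedBy p S₁ G H hG hH hHG h0' h1
  simp only [← ex_bernoulliWeight_ind] at hT hTp
  exact ⟨hT, hTp⟩

/-- **The next rung, stated**: the two-level laws for tops sharing ONE coin would give Kahn's `C_3` for every triple in which two of the
events share at most TWO coins (the hypothesis is OPEN and census-clean; bnk-2 gen 16). [this work] -/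
theorem prodBernoulli_sahiE3_nonneg_of_card_inter_le_two_of_twoLevelSharedOne (p : ι → unitInterval)
    (hyp : ∀ (S₀ S₁ : Finset ι) (G H : Fin 3 → Set (Set ι)), (∀ i, IsUpperSet (G i)) → (∀ i, IsUpperSet (H i)) → (∀ i, H i ⊆ G i) →
      DeterminedBy (G 0) (↑S₀ : Set ι) → DeterminedBy (G 1) (↑S₁ : Set ι) → (S₀ ∩ S₁).card ≤ 1 →
        0 ≤ twoLevelForm (fun X => ex (bernoulliWeight p) (ind X)) G H ∧
        0 ≤ twoLevelForm (fun X => ex (bernoulliWeight p) (ind X)) G H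
              - ∏ i, (ex (bernoulliWeight p) (ind (G i)) - ex (bernoulliWeight p) (ind (H i))))
    {S₀ S₁ : Finset ι} {A B C : Set (Set ι)} (hA : IsUpperSet A) (hB : IsUpperSet B) (hC : IsUpperSet C)
    (hAS : DeterminedBy A (↑S₀ : Set ι)) (hBS : DeterminedBy B (↑S₁ : Set ι)) (hS : (S₀ ∩ S₁).card ≤ 2) :
    0 ≤ Literature.Probability.LatticeModels.sahiE3 (prodBernoulli p) A B C := by
  rw [← sahiE_three_ind]
  exact sahiE_three_nonneg_of_twoLevelShared p 1 hyp 2 le_rfl S₀ S₁ A B C hA hB hC hAS hBS hS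


/-! ### The ladder under the WEAKER hypothesis "bottoms determined by the same supports" (bnk-2 gen 17)

The induction in `sahiE_three_nonneg_of_twoLevelShared` only ever applies the two-level laws to the pair of SECTIONS of one
triple `(A, B, C)` along a shared coin `e`; there the bottoms `H 0 = A^{e←0}`, `H 1 = B^{e←0}` are determined by the same sets
`S₀ ∖ {e}`, `S₁ ∖ {e}` as the tops.  So the hypothesis may be restricted to such pairs: the rung `k` below asks for the two laws only
at nested pairs `H ⊆ G` with `G 0, H 0` determined by `S₀`, `G 1, H 1` determined by `S₁`, `|S₀ ∩ S₁| ≤ k` (slot `2` unrestricted).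
This is the form in which rung `k = 1` was censused (memo `run/shared/lean/prim/prim-l12/FROM-prim-bnk-2-g17-POLARIZATION.md`:
after deleting the one shared coin the slot-`0` and slot-`1` data live on disjoint blocks; `n ≤ 5` exhaustive, larger `n` sampled,
`0` negatives) and to which the polarisation identities of that memo reduce it.  Rung `k = 1` remains OPEN. [this work] -/

/-- **THE SHARED-COINS LADDER, weak-bottom form.**  If, under the product weight `p`, both two-level laws hold at every nested pair of
increasing triples whose slot-`0` events `G 0 ⊇ H 0` are determined by `S₀` and slot-`1` events `G 1 ⊇ H 1` by `S₁` with
`|S₀ ∩ S₁| ≤ k`, then `E_3(μ_p; 1_A, 1_B, 1_C) ≥ 0` whenever `A`, `B` are increasing and determined by sets sharing at most `k + 1`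
coins and `C` is increasing.  Same induction as `sahiE_three_nonneg_of_twoLevelShared`; only the determinacy of the `0`-sections is
fed to the hypothesis in addition. [this work] -/
theorem sahiE_three_nonneg_of_twoLevelShared_weak (p : ι → unitInterval) (k : ℕ)
    (hyp : ∀ (S₀ S₁ : Finset ι) (G H : Fin 3 → Set (Set ι)), (∀ i, IsUpperSet (G i)) → (∀ i, IsUpperSet (H i)) → (∀ i, H i ⊆ G i) →
      DeterminedBy (G 0) (↑S₀ : Set ι) → DeterminedBy (G 1) (↑S₁ : Set ι) →
      DeterminedBy (H 0) (↑S₀ : Set ι) → DeterminedBy (H 1) (↑S₁ : Set ι) → (S₀ ∩ S₁).card ≤ k →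
        0 ≤ twoLevelForm (fun X => ex (bernoulliWeight p) (ind X)) G H ∧
        0 ≤ twoLevelForm (fun X => ex (bernoulliWeight p) (ind X)) G H
              - ∏ i, (ex (bernoulliWeight p) (ind (G i)) - ex (bernoulliWeight p) (ind (H i)))) :
    ∀ (j : ℕ), j ≤ k + 1 → ∀ (S₀ S₁ : Finset ι) (A B C : Set (Set ι)), IsUpperSet A → IsUpperSet B → IsUpperSet C →
      DeterminedBy A (↑S₀ : Set ι) → DeterminedBy B (↑S₁ : Set ι) → (S₀ ∩ S₁).card ≤ j →
        0 ≤ sahiE (bernoulliWeight p) 3 ![ind A, ind B, ind C] := by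
  intro j
  induction j with
  | zero =>
    intro _ S₀ S₁ A B C hA hB hC hAS hBS hS
    have hd : Disjoint S₀ S₁ := Finset.disjoint_iff_inter_eq_empty.2 (Finset.card_eq_zero.1 (Nat.le_zero.1 hS))
    rw [sahiE_three_ind]
    exact prodBernoulli_sahiE3_nonneg_of_determinedBy p hd hAS hBS hA hB hC MeasurableSet.of_discrete
      MeasurableSet.of_discrete MeasurableSet.of_discrete
  | succ j ih =>
    intro hj S₀ S₁ A B C hA hB hC hAS hBS hS
    by_cases hle : (S₀ ∩ S₁).card ≤ j
    · exact ih (by omega) S₀ S₁ A B C hA hB hC hAS hBS hle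
    · have hpos : 0 < (S₀ ∩ S₁).card := by omega
      obtain ⟨e, he⟩ := Finset.card_pos.1 hpos
      have hAsec : ∀ b, DeterminedBy (secAt e b A) (↑(S₀.erase e) : Set ι) := fun b => determinedBy_secAt e b hAS
      have hBsec : ∀ b, DeterminedBy (secAt e b B) (↑(S₁.erase e) : Set ι) := fun b => determinedBy_secAt e b hBS
      have hcard : (S₀.erase e ∩ S₁.erase e).card ≤ j := by
        have h1 : S₀.erase e ∩ S₁.erase e = (S₀ ∩ S₁).erase e := by
          ext x; simp only [Finset.mem_inter, Finset.mem_erase]; tauto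
        rw [h1, Finset.card_erase_of_mem he]
        omega
      have hB0 : 0 ≤ sahiE (bernoulliWeight p) 3 ![ind (secAt e false A), ind (secAt e false B), ind (secAt e false C)] :=
        ih (by omega) _ _ _ _ _ (isUpperSet_secAt e false hA) (isUpperSet_secAt e false hB) (isUpperSet_secAt e false hC)
          (hAsec false) (hBsec false) hcard
      have hB3 : 0 ≤ sahiE (bernoulliWeight p) 3 ![ind (secAt e true A), ind (secAt e true B), ind (secAt e true C)] :=
        ih (by omega) _ _ _ _ _ (isUpperSet_secAt e true hA) (isUpperSet_secAt e true hB) (isUpperSet_secAt e true hC)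
          (hAsec true) (hBsec true) hcard
      have hG : ∀ i, IsUpperSet ((![secAt e true A, secAt e true B, secAt e true C] : Fin 3 → Set (Set ι)) i) := by
        intro i; fin_cases i
        · exact isUpperSet_secAt e true hA
        · exact isUpperSet_secAt e true hB
        · exact isUpperSet_secAt e true hC
      have hH : ∀ i, IsUpperSet ((![secAt e false A, secAt e false B, secAt e false C] : Fin 3 → Set (Set ι)) i) := by
        intro i; fin_cases i
        · exact isUpperSet_secAt e false hA
        · exact isUpperSet_secAt e false hB
        · exact isUpperSet_secAt e false hC
      have hHG : ∀ i, (![secAt e false A, secAt e false B, secAt e false C] : Fin 3 → Set (Set ι)) i ⊆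
          (![secAt e true A, secAt e true B, secAt e true C] : Fin 3 → Set (Set ι)) i := by
        intro i; fin_cases i
        · exact SahiTwoLevel.secAt_false_subset_true e hA
        · exact SahiTwoLevel.secAt_false_subset_true e hB
        · exact SahiTwoLevel.secAt_false_subset_true e hC
      have h0 : DeterminedBy ((![secAt e true A, secAt e true B, secAt e true C] : Fin 3 → Set (Set ι)) 0) (↑(S₀.erase e) : Set ι) :=
        hAsec true
      have h1 : DeterminedBy ((![secAt e true A, secAt e true B, secAt e true C] : Fin 3 → Set (Set ι)) 1) (↑(S₁.erase e) : Set ι) :=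
        hBsec true
      have h0' : DeterminedBy ((![secAt e false A, secAt e false B, secAt e false C] : Fin 3 → Set (Set ι)) 0)
          (↑(S₀.erase e) : Set ι) := hAsec false
      have h1' : DeterminedBy ((![secAt e false A, secAt e false B, secAt e false C] : Fin 3 → Set (Set ι)) 1)
          (↑(S₁.erase e) : Set ι) := hBsec false
      obtain ⟨hT, hTp⟩ := hyp (S₀.erase e) (S₁.erase e) _ _ hG hH hHG h0 h1 h0' h1' (by omega)
      have hdec := SahiCoordinateBernstein.sahiE_three_decomp_coord p e ![A, B, C]
      rw [Pointwise.ind_vec3, SahiCoordinateTwoThirds.ind_secAt_vec3, SahiCoordinateTwoThirds.ind_secAt_vec3] at hdec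
      have hb1 := SahiTwoLevel.coordPiece₁_add_eq_twoLevelForm p e A B C
      have hb2 := SahiTwoLevel.coordPiece₂_add_eq_twoLevelPlus p e A B C
      have hT' : 0 ≤ SahiCoordinateBernstein.coordPiece₁ p e ![A, B, C]
          + sahiE (bernoulliWeight p) 3 ![ind (secAt e false A), ind (secAt e false B), ind (secAt e false C)]
          + sahiE (bernoulliWeight p) 3 ![ind (secAt e true A), ind (secAt e true B), ind (secAt e true C)] := by
        rw [hb1]; exact hT
      have hTp' : 0 ≤ SahiCoordinateBernstein.coordPiece₂ p e ![A, B, C]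
          + sahiE (bernoulliWeight p) 3 ![ind (secAt e false A), ind (secAt e false B), ind (secAt e false C)]
          + sahiE (bernoulliWeight p) 3 ![ind (secAt e true A), ind (secAt e true B), ind (secAt e true C)] := by
        rw [hb2]; exact hTp
      rw [hdec]
      have hs0 : 0 ≤ (p e : ℝ) := (p e).2.1
      have hs1 : 0 ≤ 1 - (p e : ℝ) := sub_nonneg.2 (p e).2.2
      nlinarith [mul_nonneg (mul_nonneg hs1 hs1) hB0, mul_nonneg (mul_nonneg hs0 hs0) hB3,
        mul_nonneg (mul_nonneg hs0 (mul_nonneg hs1 hs1)) hT', mul_nonneg (mul_nonneg (mul_nonneg hs0 hs0) hs1) hTp']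

/-- The weak-bottom hypothesis is implied by the original one (it quantifies over fewer pairs); in particular rung `k = 0` of the
weak ladder is discharged by `twoLevelShared_zero`. [this work] -/
theorem twoLevelShared_zero_weak (p : ι → unitInterval) (S₀ S₁ : Finset ι) (G H : Fin 3 → Set (Set ι))
    (hG : ∀ i, IsUpperSet (G i)) (hH : ∀ i, IsUpperSet (H i)) (hHG : ∀ i, H i ⊆ G i)
    (h0 : DeterminedBy (G 0) (↑S₀ : Set ι)) (h1 : DeterminedBy (G 1) (↑S₁ : Set ι))
    (_h0' : DeterminedBy (H 0) (↑S₀ : Set ι)) (_h1' : DeterminedBy (H 1) (↑S₁ : Set ι)) (hS : (S₀ ∩ S₁).card ≤ 0) :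
    0 ≤ twoLevelForm (fun X => ex (bernoulliWeight p) (ind X)) G H ∧
    0 ≤ twoLevelForm (fun X => ex (bernoulliWeight p) (ind X)) G H
          - ∏ i, (ex (bernoulliWeight p) (ind (G i)) - ex (bernoulliWeight p) (ind (H i))) :=
  twoLevelShared_zero p S₀ S₁ G H hG hH hHG h0 h1 hS

/-- **Rung `k = 1`, weak-bottom form**: the two-level laws at nested pairs whose slot-`0` data are determined by `S₀`, slot-`1` data by
`S₁`, `|S₀ ∩ S₁| ≤ 1` (after deleting the shared coin: INDEPENDENT blocks in slots `0` and `1`, two nested levels each) would give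
Kahn's `C_3` for every triple in which two of the events share at most TWO coins.  The hypothesis is OPEN and census-clean (bnk-2 gen 16/17). [this work] -/
theorem prodBernoulli_sahiE3_nonneg_of_card_inter_le_two_of_twoLevelSharedOne_weak (p : ι → unitInterval)
    (hyp : ∀ (S₀ S₁ : Finset ι) (G H : Fin 3 → Set (Set ι)), (∀ i, IsUpperSet (G i)) → (∀ i, IsUpperSet (H i)) → (∀ i, H i ⊆ G i) →
      DeterminedBy (G 0) (↑S₀ : Set ι) → DeterminedBy (G 1) (↑S₁ : Set ι) →
      DeterminedBy (H 0) (↑S₀ : Set ι) → DeterminedBy (H 1) (↑S₁ : Set ι) → (S₀ ∩ S₁).card ≤ 1 →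
        0 ≤ twoLevelForm (fun X => ex (bernoulliWeight p) (ind X)) G H ∧
        0 ≤ twoLevelForm (fun X => ex (bernoulliWeight p) (ind X)) G H
              - ∏ i, (ex (bernoulliWeight p) (ind (G i)) - ex (bernoulliWeight p) (ind (H i))))
    {S₀ S₁ : Finset ι} {A B C : Set (Set ι)} (hA : IsUpperSet A) (hB : IsUpperSet B) (hC : IsUpperSet C)
    (hAS : DeterminedBy A (↑S₀ : Set ι)) (hBS : DeterminedBy B (↑S₁ : Set ι)) (hS : (S₀ ∩ S₁).card ≤ 2) :
    0 ≤ Literature.Probability.LatticeModels.sahiE3 (prodBernoulli p) A B C := by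
  rw [← sahiE_three_ind]
  exact sahiE_three_nonneg_of_twoLevelShared_weak p 1 hyp 2 le_rfl S₀ S₁ A B C hA hB hC hAS hBS hS

end SahiTwoLevelIndep

end Summit.CriticalPhenomena.PercolationContinuityZ3.Theorems
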